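import Summits.Ventures.HodgeRepro.SexticBridge
import Summits.Ventures.HodgeRepro.Faces

/-!
# The sealed degree-6 faces (§A.3) are faces of the model; `SumTwo` structurally

Blind re-derivation cell `pub-hodge-repro`, seat `typer` (gen 3).  Continues `SexticBridge.lean` /
`Faces.lean`.

The sealed `Statements.lean` §A.3 builds the corners of a face `(Φ; p, p′)` as the list
`corners Φ p p′ = [Φ, flip p (bar Φ), flip p′ (bar Φ), flip p′ (flip p Φ)]` and its `Census` clause (2)
says `SumTwo`: for every face and every `i : ℤ/6` exactly two corners contain `i`.  Here:

* `toC6_flip'`, `corners_map`: the sealed corners, read in `C6`, are `faceCorners cc_C6 (toC6 Φ) σᵖ σᵖ′`;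
* `length_filter_corners`, `sealed_sumTwo_iff`: the sealed count is the model count, so the sealed
  `SumTwo` clause for `(Φ; p, p′)` IS `FaceReduce.SumTwo` of the model corners;
* `mem_faces_iff`, `place_ne_of_mem`: the sealed `faces` are the pairs (CM type, two distinct places);
* **`census_sumTwo_structural`**: the sealed clause (2) proved from the general `sumTwo_faceCorners`
  of `Faces.lean` — no enumeration — and `census_corners_cmTypes_structural`: the "four corners are CM
  types" part of clause (3), from `isCMType_faceCorners`.

These are alternative proofs of two sealed sub-clauses (the kernel `decide` proofs of the provers stand);
their point is that the sealed numbers are instances of statements about every Galois CM field.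
-/

open Finset
open scoped Pointwise

namespace HodgeRepro

namespace SexticBridge

open Summit.Ventures.HodgeRepro.FaceCensus.Sextic
open Multiplicative

/-- The sealed flip is the model flip `flipAt` at the place of `σᵖ`. -/
theorem toC6_flip' (p : ZMod 6) (T : Finset (ZMod 6)) :
    toC6 (Coordinates.flip p T) = flipAt cc_C6 (ofAdd p) (toC6 T) := by
  unfold flipAt place
  exact toC6_flip p T

/-- The sealed corner list, read in `C6`, is the model's `faceCorners`. -/
theorem corners_map (Φ : Finset (ZMod 6)) (p p' : ZMod 6) :
    (Coordinates.corners Φ p p').map toC6 =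
      [faceCorners cc_C6 (toC6 Φ) (ofAdd p) (ofAdd p') 0, faceCorners cc_C6 (toC6 Φ) (ofAdd p) (ofAdd p') 1,
        faceCorners cc_C6 (toC6 Φ) (ofAdd p) (ofAdd p') 2, faceCorners cc_C6 (toC6 Φ) (ofAdd p) (ofAdd p') 3] := by
  simp only [Coordinates.corners, List.map_cons, List.map_nil, faceCorners, toC6_flip', toC6_bar]

/-- For each embedding `i`, the sealed number of corners containing `i` is the number of model corners
containing `σⁱ`. -/
theorem length_filter_corners (Φ : Finset (ZMod 6)) (p p' i : ZMod 6) :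
    ((Coordinates.corners Φ p p').filter fun T => i ∈ T).length =
      (univ.filter fun k : Fin 4 => ofAdd i ∈ faceCorners cc_C6 (toC6 Φ) (ofAdd p) (ofAdd p') k).card := by
  have e : ∀ T : Finset (ZMod 6), (ofAdd i ∈ toC6 T ↔ i ∈ T) := fun T => by simp
  rw [Finset.card_filter, Fin.sum_univ_four]
  simp only [Coordinates.corners, List.filter_cons, List.filter_nil, faceCorners, ← toC6_bar, ← toC6_flip',
    e]
  by_cases h0 : i ∈ Φ <;> by_cases h1 : i ∈ Coordinates.flip p (Coordinates.bar Φ) <;>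
    by_cases h2 : i ∈ Coordinates.flip p' (Coordinates.bar Φ) <;>
    by_cases h3 : i ∈ Coordinates.flip p' (Coordinates.flip p Φ) <;> simp [h0, h1, h2, h3]

/-- The sealed `SumTwo` clause for `(Φ; p, p′)` is `SumTwo` of the model corners. -/
theorem sealed_sumTwo_iff (Φ : Finset (ZMod 6)) (p p' : ZMod 6) :
    (∀ i : ZMod 6, ((Coordinates.corners Φ p p').filter fun T => i ∈ T).length = 2) ↔
      SumTwo (faceCorners cc_C6 (toC6 Φ) (ofAdd p) (ofAdd p')) := by
  simp only [length_filter_corners]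
  constructor
  · intro h x
    have := h (toAdd x)
    rwa [ofAdd_toAdd] at this
  · intro h i
    exact h (ofAdd i)

/-- The sealed `faces`: a sealed CM type and two distinct places among `{0, 1, 2}`. -/
theorem mem_faces_iff (f : Finset (ZMod 6) × ZMod 6 × ZMod 6) :
    f ∈ Coordinates.faces ↔
      f.1 ∈ Coordinates.cmTypes ∧ f.2.1 ∈ ({0, 1, 2} : Finset (ZMod 6)) ∧
        f.2.2 ∈ ({0, 1, 2} : Finset (ZMod 6)) ∧ f.2.1 ≠ f.2.2 := by
  simp only [Coordinates.faces, mem_filter, mem_product, and_assoc]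

/-- Two distinct place representatives in `{0, 1, 2}` give distinct places of `C6` (`decide`). -/
theorem place_ne_of_mem (p p' : ZMod 6) (hp : p ∈ ({0, 1, 2} : Finset (ZMod 6)))
    (hp' : p' ∈ ({0, 1, 2} : Finset (ZMod 6))) (h : p ≠ p') :
    (ofAdd p' : C6) ∉ place cc_C6 (ofAdd p) := by
  revert p p'; decide

/-- **The sealed clause (2) (`SumTwo` for every face), structurally**: an instance of
`sumTwo_faceCorners`, valid for every Galois CM field — no enumeration. -/
theorem census_sumTwo_structural :
    ∀ f ∈ Coordinates.faces, ∀ i : ZMod 6,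
      ((Coordinates.corners f.1 f.2.1 f.2.2).filter fun T => i ∈ T).length = 2 := by
  intro f hf
  rw [mem_faces_iff] at hf
  obtain ⟨hT, hp, hp', hne⟩ := hf
  rw [sealed_sumTwo_iff]
  exact sumTwo_faceCorners cc_C6_isComplexConj ((mem_cmTypes_iff _).1 hT) (place_ne_of_mem _ _ hp hp' hne)

/-- **The "four corners are CM types" part of the sealed clause (3), structurally**: an instance of
`isCMType_faceCorners`. -/
theorem census_corners_cmTypes_structural :
    ∀ f ∈ Coordinates.faces, ∀ T ∈ Coordinates.corners f.1 f.2.1 f.2.2, T ∈ Coordinates.cmTypes := by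
  intro f hf T hT
  rw [mem_faces_iff] at hf
  rw [mem_cmTypes_iff]
  have hmem : toC6 T ∈ (Coordinates.corners f.1 f.2.1 f.2.2).map toC6 := List.mem_map.2 ⟨T, hT, rfl⟩
  rw [corners_map] at hmem
  simp only [List.mem_cons, List.not_mem_nil, or_false] at hmem
  have hΦ := (mem_cmTypes_iff _).1 hf.1
  rcases hmem with h | h | h | h <;> rw [h] <;>
    exact isCMType_faceCorners cc_C6_isComplexConj hΦ _ _ _

end SexticBridge

end HodgeRepro
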